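import Summits.BirchSwinnertonDyer.BirchSwinnertonDyer.Theorems.CumulativeHeegnerLeopoldtCumulativeHeegnerInclusionAtThreeTraceZeroHeegnerModuleTorsion
import Literature.NumberTheory.EllipticCurves.AnticyclotomicCompactSelmer
import HarnessLib

/-!
# Route `CumulativeHeegnerLeopoldt`, crux K1 `CumulativeHeegnerInclusionAtThree` (stmt-BirchSwinnertonDyer-24198),
# line `birth`, stub A (= crux stmt-26896): the trace-zero barrier in HOWARD 2005's RATIONAL currency `ℋ ⊂ 𝒮_∞`

Lead prover bsd-line-chl-k1-p1 g3, `--supports stmt-BirchSwinnertonDyer-24198`. THEOREMS ONLY (no definition, no named fact,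
no `sorry`); sequel of `…TraceZeroHeegnerModule` (p621811/p622174) and `…TraceZeroHeegnerModuleTorsion` (p622685/p623095).
Howard 2005 (Λ-adic Gross–Zagier / derivative side) works with the `Λ[1/p]`-module `𝒮_∞ = 𝔖[1/p]` and its Heegner
submodule `ℋ = Λ_ℚ · ỹ_∞` (tree: `LambdaAdicSelmerData.SInfty`, `ratHeegnerModule D F` = the `Λ[1/p]`-span of the image of
`heegnerModule D F`, `ratHeegnerCharIdeal`). Since the integral module vanishes for a (eventually) torsion-trace family when
`E(K_∞)[p^∞] = 0`, so does `ℋ`, and `char(𝒮_∞/ℋ) = char(𝒮_∞)`: the Howard-2005-shaped statements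
(`Howard2005_exists_lambdaAdicHeightData`-consumers, `ratHeegnerCharIdeal`-valued identities) are as degenerate at a trace-zero
prime as the Howard-2004 ones. Note that inverting `p` does NOT rescue the cumulative class: `𝒮_∞` only allows BOUNDED
denominators (`exists_pow_smul_eq_toSInfty`), while the cumulative family needs `p^{-k}` at layer `k` (§6 of the first file).
BSD is not proved by any of this.

References: [Howard2005] §1 (pp. 814–815: `𝒮_∞`, `ℋ`, `char(𝒮_∞/ℋ)`); [PerrinRiou1987BSMF] §3.4 Prop. 10; Cornut–Vatsal 2007
(LMS LNS 320) Lemma 4.9 (iii) / §6.4 Lemma 6.14.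
-/

set_option autoImplicit false
set_option linter.dupNamespace false

noncomputable section

open scoped Classical

open WeierstrassCurve Literature.NumberTheory.EllipticCurves PowerSeries

universe u

namespace Summit.BirchSwinnertonDyer.BirchSwinnertonDyer.Theorems.CumulativeHeegnerInclusionAtThreeTraceZero

variable {K : Type u} [Field K] [NumberField K] {N : ℕ} [NeZero N] {W : WeierstrassCurve ℚ} [W.IsElliptic]
  {p : ℕ} [Fact p.Prime] {κ : ZpExtension K p} {γ : Field.absoluteGaloisGroup K}
  {jbar : AlgebraicClosure K →+* ℂ}

omit [W.IsElliptic] in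
/-- If the integral Heegner module `ℋ_∞(F) ⊆ 𝔖` vanishes, so does Howard's rational Heegner submodule `ℋ ⊆ 𝒮_∞ = 𝔖[1/p]`
(it is the `Λ[1/p]`-span of the image of `ℋ_∞`). [cite: Howard2005, §1 (p. 814, ℋ)] -/
theorem ratHeegnerModule_eq_bot_of_heegnerModule_eq_bot (D : (W.baseChange K).LambdaAdicSelmerData κ γ)
    (F : HeegnerFamily N W K κ jbar) (h : heegnerModule D F = ⊥) : D.ratHeegnerModule F = ⊥ := by
  rw [LambdaAdicSelmerData.ratHeegnerModule, Submodule.span_eq_bot]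
  rintro x ⟨s, hs, rfl⟩
  have hs0 : s = 0 := by simpa [h] using hs
  rw [hs0, map_zero]

omit [W.IsElliptic] in
/-- … and then `char(𝒮_∞/ℋ) = char(𝒮_∞)` (`𝒮_∞/0 ≅ 𝒮_∞`). [cite: Howard2005, §1 (p. 815, char(𝒮_∞/ℋ))] -/
theorem ratHeegnerCharIdeal_eq_charIdeal_of_heegnerModule_eq_bot (D : (W.baseChange K).LambdaAdicSelmerData κ γ)
    (F : HeegnerFamily N W K κ jbar) (h : heegnerModule D F = ⊥) :
    D.ratHeegnerCharIdeal F = Module.charIdeal (ratIwasawaAlgebra p) D.SInfty := by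
  rw [LambdaAdicSelmerData.ratHeegnerCharIdeal]
  exact Module.charIdeal_eq_of_linearEquiv
    (Submodule.quotEquivOfEqBot _ (ratHeegnerModule_eq_bot_of_heegnerModule_eq_bot D F h))

/-- **BARRIER LEMMA in Howard 2005's currency**: if `E(K_∞)[p^∞] = 0` and the traces `Tr_{K_{j+1}/K_j} z_{j+1}` are torsion for
all `j ≥ j₀` (Cornut–Vatsal 2007, L. 4.9 (iii) for good CM points at `p² ∣ N`), then `ℋ = ⊥` in `𝒮_∞` and
`char(𝒮_∞/ℋ) = char(𝒮_∞)`. [cite: Howard2005, §1 (pp. 814–815)] [cite: PerrinRiou1987BSMF, §3.4 Prop. 10] -/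
theorem ratHeegnerModule_eq_bot_of_eventually_traceTorsion_of_fixedPoints_eq_bot (hγ : κ.IsTopGenerator γ)
    (hbot : FixedPoints.addSubgroup κ.kerSubgroup ((W.baseChange K).geomPrimaryTorsion p) = ⊥)
    (D : (W.baseChange K).LambdaAdicSelmerData κ γ) (F : HeegnerFamily N W K κ jbar) (j₀ : ℕ)
    (hTT : ∀ j, j₀ ≤ j → ∃ m : ℤ, m ≠ 0 ∧ m • (∑ i ∈ Finset.range p, (γ ^ (p ^ j * i)) • F.z (j + 1)) = 0) :
    D.ratHeegnerModule F = ⊥ ∧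
      D.ratHeegnerCharIdeal F = Module.charIdeal (ratIwasawaAlgebra p) D.SInfty :=
  have h := heegnerModule_eq_bot_of_eventually_traceTorsion_of_fixedPoints_eq_bot hγ hbot D F j₀ hTT
  ⟨ratHeegnerModule_eq_bot_of_heegnerModule_eq_bot D F h, ratHeegnerCharIdeal_eq_charIdeal_of_heegnerModule_eq_bot D F h⟩

/-- The same from `E(K)[p] = 0`. [cite: Howard2005, §1 (pp. 814–815)] [cite: GreenbergLNM1716, §4 p. 109] -/
theorem ratHeegnerModule_eq_bot_of_eventually_traceTorsion (hγ : κ.IsTopGenerator γ)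
    (hE : ∀ P : (W.baseChange K).toAffine.Point, p • P = 0 → P = 0)
    (D : (W.baseChange K).LambdaAdicSelmerData κ γ) (F : HeegnerFamily N W K κ jbar) (j₀ : ℕ)
    (hTT : ∀ j, j₀ ≤ j → ∃ m : ℤ, m ≠ 0 ∧ m • (∑ i ∈ Finset.range p, (γ ^ (p ^ j * i)) • F.z (j + 1)) = 0) :
    D.ratHeegnerModule F = ⊥ ∧
      D.ratHeegnerCharIdeal F = Module.charIdeal (ratIwasawaAlgebra p) D.SInfty :=
  ratHeegnerModule_eq_bot_of_eventually_traceTorsion_of_fixedPoints_eq_bot hγ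
    ((W.baseChange K).fixedPoints_kerSubgroup_geomPrimaryTorsion_eq_bot κ hE) D F j₀ hTT

section LeopoldtCellRat

variable {K₀ : Type} [Field K₀] [NumberField K₀] {W₀ : WeierstrassCurve ℚ} [W₀.IsElliptic] [W₀.IsGloballyMinimal]
  {N₀ : ℕ} [NeZero N₀] {κ₃ : ZpExtension K₀ 3} {γ₃ : Field.absoluteGaloisGroup K₀} {jbar₀ : AlgebraicClosure K₀ →+* ℂ}

/-- **On the Leopoldt cell of crux K1 / A**, Howard 2005's `ℋ ⊂ 𝒮_∞` vanishes for every Heegner family with eventually torsion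
traces, and `char(𝒮_∞/ℋ) = char(𝒮_∞)` (torsion input p615628). [cite: Howard2005, §1 (pp. 814–815)] [cite: Castella2018Erratum, Lemma 2.1] -/
theorem ratHeegnerModule_eq_bot_on_leopoldtCell_of_eventually_traceTorsion
    (hO6 : Summit.BirchSwinnertonDyer.Rank1Residual.Additive.ClassO6 W₀ 3)
    (hline : ∃ Φ : AddSubgroup (WeierstrassCurve.geomTorsion W₀ ((3 : ℕ) : ℤ)),
        Literature.NumberTheory.EllipticCurves.Rank1Residual.IsRationalLine W₀ 3 Φ ∧
        ∀ (v : IsDedekindDomain.HeightOneSpectrum (NumberField.RingOfIntegers ℚ)),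
          ((3 : ℕ) : NumberField.RingOfIntegers ℚ) ∈ v.asIdeal → ∀ 𝔓 ∈ v.primesAbove,
          ¬ (∀ g ∈ 𝔓.decompositionSubgroup (Field.absoluteGaloisGroup ℚ), ∀ P ∈ Φ, g • P = P) ∧
          ¬ (∀ g ∈ 𝔓.decompositionSubgroup (Field.absoluteGaloisGroup ℚ),
              ∀ P : WeierstrassCurve.geomTorsion W₀ ((3 : ℕ) : ℤ), g • P - P ∈ Φ))
    (hN : W₀.conductorNorm ℤ = N₀) (hK : Literature.NumberTheory.EllipticCurves.IsImaginaryQuadratic K₀)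
    (hHg : Literature.NumberTheory.EllipticCurves.SatisfiesHeegnerHypothesis N₀ K₀)
    (hγ : κ₃.IsTopGenerator γ₃) (D : (W₀.baseChange K₀).LambdaAdicSelmerData κ₃ γ₃)
    (F : HeegnerFamily N₀ W₀ K₀ κ₃ jbar₀) (j₀ : ℕ)
    (hTT : ∀ j, j₀ ≤ j → ∃ m : ℤ, m ≠ 0 ∧ m • (∑ i ∈ Finset.range 3, (γ₃ ^ (3 ^ j * i)) • F.z (j + 1)) = 0) :
    D.ratHeegnerModule F = ⊥ ∧
      D.ratHeegnerCharIdeal F = Module.charIdeal (ratIwasawaAlgebra 3) D.SInfty :=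
  ratHeegnerModule_eq_bot_of_eventually_traceTorsion_of_fixedPoints_eq_bot hγ
    (CumulativeHeegnerInclusionAtThreeCellNoThreeTorsion.cell_fixedPoints_kerSubgroup_eq_bot W₀ N₀ K₀ hO6 hline hN
      hK hHg κ₃) D F j₀ hTT

end LeopoldtCellRat

end Summit.BirchSwinnertonDyer.BirchSwinnertonDyer.Theorems.CumulativeHeegnerInclusionAtThreeTraceZero

end
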